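import Literature.MathematicalPhysics.QuantumFieldTheory.Balaban1983to89.B5Eq129FreeResolventKernelMonotone
import Literature.MathematicalPhysics.QuantumFieldTheory.Balaban1983to89.B5Eq129FreeResolventFibreCollapse
import Literature.MathematicalPhysics.QuantumFieldTheory.Balaban1983to89.B5Eq129FreeResolventCycleProfile

/-!
# `Balaban1983to89.B5Eq129FreeResolventGradientRow` — T. Bałaban, *Propagators and renormalization transformations for lattice gauge
# theories. I*, Commun. Math. Phys. **95** (1984) 17–40 [Balaban1984PropagatorsI] (1.29) p. 23 (free lattice operators on the finite torus), serving
# [Balaban1985BackgroundPropagators] Thm 3.1 (3.42) p. 397 (the `|∇G|` line, flat case): **THE ∇-ROW OF THE FREE MASSIVE RESOLVENT KERNEL ON ANY FINITE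
# TORUS — `Σ_x|k(x+e_ν) − k(x)| = (2q∕(t²(1−q²)))·(1−q^M)(1−q^{M′})∕(1−q^{N_ν}) ≤ 2∕√(m² + 4mt²)`, INDEPENDENT OF `d` AND OF THE VOLUME; and the
# two-argument row `Σ_y|G(x+e_ν,y) − G(x,y)| ≤ 2∕√(m²+4mt²)` of the Green's function** — the capstone of `…KernelMonotone` (one sign per fibre),
# `…FibreCollapse` (transverse collapse) and `…CycleProfile` (closed form): the (K∇) letter VALUE of the pub-balaban NE9 chain's storey J (row L13 of
# `t4/ROUTES-NE9.md`; planner sheet P-J-1 of `t4-ne9-idea-1` g121∕g122 «S₁ ≤ 2∕√(4+η²) < 1»; OWNER t4-ne9-p1 g90 W-5: «the load-bearing height-free claim»)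

statement-level skeleton of published theorems with citation tags; proofs where landed; nothing here is a claim about the Yang–Mills mass gap

CITATION HEADER (lean-in-tree rule).  Audit cell `pub-balaban`, sub-cell `t4`, BINDER row NE9; filed by NE9 crux-team LEAF PROVER 05
(`b2b-balaban-t4-ne9-formalise-leaf-05`, gen 80).  OBJECT: [Balaban1984PropagatorsI] (1.29) p. 23's free stencil in the encoding of
`B5Eq129FreeResolventSupBound` (`Tor N`, `unitVec`; the resolvent equation as a hypothesis; no `def`); at `t = η⁻¹` it is the flat (`U = 1`) `η⁻²`-stencil
of [Balaban1985BackgroundPropagators] §3 (the scalar model of `Δ^η(U)` p. 392).  CONTENT: [folklore] composition BY NAME of the three files.  Nothing of print is asserted.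

WHAT IS PROVED (sorry-free; proof lane — 0 `def`).
* **`sum_abs_sub_eq_closedForm`** (`N_ν ≥ 2`); **`sum_abs_sub_le`** (every `ν`, every torus: `≤ 2∕√(m² + 4mt²)`); **`sum_abs_green_sub_le`**
  (the Green's function `G(x,y) = k(x − y)` by uniqueness; its gradient row); **`inv_eta_mul_sum_abs_green_sub_le`** (`t = η⁻¹`:
  `η⁻¹Σ_y|G(x+e_ν,y) − G(x,y)| ≤ 2∕√(m²η² + 4m)`, `= 2∕√(η² + 4) < 1` at `m = 1` — the storey-J letter as the sheet writes it).
* §2 **`exists_green`** (the Green's function of `L₀ + m` exists: injective ⟹ surjective in finite dimension); **`apply_eq_sum_green_smul`**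
  (a VECTOR-valued solution of `(L₀ + m)u = g` in a real normed space is `u(x) = Σ_y G(x,y)•g(y)` — functionals + scalar uniqueness + Hahn–Banach);
  **`norm_apply_sub_le_of_resolvent`** (the letter in SOLUTION shape: `‖g‖ ≤ F` ⟹ `‖u(x+e_ν) − u(x)‖ ≤ (2∕√(m² + 4mt²))·F`).
HONEST SCOPE.  FLAT stencil only (the sign argument needs reflection symmetry — no covariant `Δ(U)`); the WEIGHTED row `Σ e^{κ|x|}|∇k|` (P-J-1b) is
NOT here.  ONE letter VALUE of ONE un-opened storey (J) of row L13; NOT the ∇-line of (3.42) for `G′_k(U)`, NOT Tier P, NOT NE9 (cell pub-balaban: NE9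
NOT PRINTED ∕ NOT PROVED; «NE9 ⇐ the named binders»; row WALLED ON A MODEL (O-NE9-1; #5 UNRULED); spine PROVED 0∕9; rung (B)+1 finite T⁴ — NOT infinite
volume, NOT mass gap, NOT BetaPertH, NOT Clay).  HONEST DEPENDENCY: continuum YM on T⁴ ⇐ BetaPertH ∧ nine spine estimates (0/9 proved); BetaPertH ⇐
(D1) ∧ (D4) ∧ CAP+tail; G-an2-4 gates asym, D1 and NE2/3/4.  NEW file importing the three files named; nothing modified.  Net new unproved facts: 0.
-/

noncomputable section

open scoped BigOperators

namespace Literature.MathematicalPhysics.QuantumFieldTheory.Balaban1983to89.B5Eq129FreeResolventGradientRow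

open B5Prop11Plancherel (Tor unitVec)
open B5Eq129FreeResolventKernelMonotone (eq_of_resolvent_eq dipole_sign_on_fibre)
open B5Eq129FreeResolventFibreCollapse (fibreSum_resolvent sum_abs_sub_eq_sum_abs_fibreSum_sub)

variable {d : ℕ} (N : Fin d → ℕ) [∀ μ, NeZero (N μ)]

/-- **THE ∇-ROW OF THE FREE RESOLVENT KERNEL ON THE TORUS, CLOSED FORM.**  Let `(L₀ + m)k = δ₀` on `Π_μ ℤ∕N_μ`
(`(L₀φ)(x) = Σ_μ t²[(φ(x) − φ(x−e_μ)) + (φ(x) − φ(x+e_μ))]`, `t ≠ 0`, `m > 0`), fix a direction `ν` with period `N_ν = M + M′ ≥ 2`,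
`M ≤ M′ ≤ M + 1`, and let `q ∈ (0,1)` be the root of `q + q⁻¹ = 2 + m∕t²`.  Then
`Σ_x |k(x + e_ν) − k(x)| = (2q∕(t²(1 − q²)))·(1 − q^M)(1 − q^{M′})∕(1 − q^{M+M′})` — INDEPENDENT of `d` and of the transverse periods:
one sign per fibre (`dipole_sign_on_fibre`) ⟹ transverse collapse (`sum_abs_sub_eq_sum_abs_fibreSum_sub`) ⟹ the cycle profile
(`fibreSum_resolvent`, `B5Eq129FreeResolventCycleProfile.sum_abs_sub_eq`). [folklore] [cite: Balaban1984PropagatorsI, (1.29) p.23] -/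
theorem sum_abs_sub_eq_closedForm (t : ℝ) (ht : t ≠ 0) {m : ℝ} (hm : 0 < m) {k : Tor N → ℝ}
    (hk : ∀ x, ∑ ν, t ^ 2 * ((k x - k (x - unitVec N ν)) + (k x - k (x + unitVec N ν))) + m * k x = if x = 0 then 1 else 0)
    (ν : Fin d) (hn : 2 ≤ N ν) {q : ℝ} (hq0 : 0 < q) (hq1 : q < 1) (hq : q + q⁻¹ = 2 + m / t ^ 2)
    (M M' : ℕ) (hMM' : M + M' = N ν) (hle : M ≤ M') (hle' : M' ≤ M + 1) :
    ∑ x : Tor N, |k (x + unitVec N ν) - k x| =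
      2 * q / (t ^ 2 * (1 - q ^ 2)) * ((1 - q ^ M) * (1 - q ^ M') / (1 - q ^ (M + M'))) := by
  rw [sum_abs_sub_eq_sum_abs_fibreSum_sub N k ν (dipole_sign_on_fibre N t hm hk ν hn M M' hMM' hle hle')]
  exact B5Eq129FreeResolventCycleProfile.sum_abs_sub_eq hn t ht hm hq0 hq1 hq
    (φ := fun s => ∑ x : Tor N, if x ν = s then k x else 0) (fibreSum_resolvent N t m hk ν) M M' hMM' hle hle'

/-- **THE UNIVERSAL BOUND OF THE ∇-ROW**: for the free resolvent kernel `(L₀ + m)k = δ₀` on ANY finite torus `Π_μ ℤ∕N_μ` (any `d`,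
any periods), `t ≠ 0`, `m > 0`, and EVERY direction `ν`:  `Σ_x |k(x + e_ν) − k(x)| ≤ 2∕√(m² + 4mt²)`.  At `t = η⁻¹` (King ∕ Bałaban's
`η⁻²`-stencil) and `m = 1` the η⁻¹-normalised gradient row is `η⁻¹Σ_x|k(x+e_ν) − k(x)| ≤ 2∕√(4 + η²) < 1`, uniformly in `η`, `d` and the
volume — the (K∇) letter VALUE of the NE9 chain's storey J (row L13 of `t4/ROUTES-NE9.md`; planner sheet P-J-1 of `t4-ne9-idea-1` g121∕g122).
[folklore] [cite: Balaban1984PropagatorsI, (1.29) p.23] -/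
theorem sum_abs_sub_le (t : ℝ) (ht : t ≠ 0) {m : ℝ} (hm : 0 < m) {k : Tor N → ℝ}
    (hk : ∀ x, ∑ ν, t ^ 2 * ((k x - k (x - unitVec N ν)) + (k x - k (x + unitVec N ν))) + m * k x = if x = 0 then 1 else 0)
    (ν : Fin d) : ∑ x : Tor N, |k (x + unitVec N ν) - k x| ≤ 2 / Real.sqrt (m ^ 2 + 4 * m * t ^ 2) := by
  by_cases hn : 2 ≤ N ν
  · obtain ⟨M, M', hMM', hle, hle'⟩ : ∃ M M' : ℕ, M + M' = N ν ∧ M ≤ M' ∧ M' ≤ M + 1 :=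
      ⟨N ν / 2, N ν - N ν / 2, by omega, by omega, by omega⟩
    rw [sum_abs_sub_eq_sum_abs_fibreSum_sub N k ν (dipole_sign_on_fibre N t hm hk ν hn M M' hMM' hle hle')]
    exact B5Eq129FreeResolventCycleProfile.sum_abs_sub_le hn t ht hm
      (φ := fun s => ∑ x : Tor N, if x ν = s then k x else 0) (fibreSum_resolvent N t m hk ν)
  · -- period one in direction `ν`: `e_ν = 0`, the row vanishes
    have hN1 : N ν = 1 := by have := NeZero.one_le (n := N ν); omega
    have hsub : Subsingleton (ZMod (N ν)) := by rw [hN1]; infer_instance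
    have he : unitVec N ν = 0 := by
      funext κ
      by_cases hκ : κ = ν
      · subst hκ; exact Subsingleton.elim _ _
      · simp [unitVec, Pi.single_eq_of_ne hκ]
    simp only [he, add_zero, sub_self, abs_zero, Finset.sum_const_zero]
    positivity

/-- **TWO-ARGUMENT FORM (the Green's function `G(x, y)` of `L₀ + m`).**  If `G : T × T → ℝ` solves `(L₀ + m)G(·, y) = δ_y` for every
`y`, then `G(x, y) = k(x − y)` (translation invariance by uniqueness) and for every `x` and direction `ν`:
`Σ_y |G(x + e_ν, y) − G(x, y)| ≤ 2∕√(m² + 4mt²)` — EXACTLY the row `max_x Σ_y |G(x + e_ν, y) − G(x, y)|` of the storey-J sheet, before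
its `η⁻¹`. [folklore] [cite: Balaban1984PropagatorsI, (1.29) p.23] -/
theorem sum_abs_green_sub_le (t : ℝ) (ht : t ≠ 0) {m : ℝ} (hm : 0 < m) {G : Tor N → Tor N → ℝ}
    (hG : ∀ y x, ∑ ν, t ^ 2 * ((G x y - G (x - unitVec N ν) y) + (G x y - G (x + unitVec N ν) y)) + m * G x y =
      if x = y then 1 else 0)
    (x : Tor N) (ν : Fin d) : ∑ y : Tor N, |G (x + unitVec N ν) y - G x y| ≤ 2 / Real.sqrt (m ^ 2 + 4 * m * t ^ 2) := by
  -- the kernel `k = G(·, 0)` and translation invariance `G(z, y) = k(z − y)`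
  set k : Tor N → ℝ := fun z => G z 0 with hkdef
  have hk : ∀ z, ∑ ν, t ^ 2 * ((k z - k (z - unitVec N ν)) + (k z - k (z + unitVec N ν))) + m * k z =
      if z = 0 then 1 else 0 := fun z => hG 0 z
  have htr : ∀ y z, G z y = k (z - y) := by
    intro y
    have h := eq_of_resolvent_eq (V := Tor N) (ι := Fin d) (fun μ w => w - unitVec N μ) (fun μ w => w + unitVec N μ)
      (sq_nonneg t) hm (φ₁ := fun w => G (w + y) y) (φ₂ := k) (ψ := fun w => if w = 0 then (1 : ℝ) else 0) ?_ hk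
    · intro z
      have := congrFun h (z - y)
      simpa only [sub_add_cancel] using this
    · intro w
      have e := hG y (w + y)
      simp only [add_sub_right_comm, add_right_comm w y, add_eq_right] at e
      simpa only [add_right_comm w _ y] using e
  simp only [htr, add_sub_right_comm]
  calc ∑ y : Tor N, |k (x - y + unitVec N ν) - k (x - y)|
      = ∑ z : Tor N, |k (z + unitVec N ν) - k z| :=
        Fintype.sum_equiv (Equiv.subLeft x) _ _ fun y => by simp only [Equiv.subLeft_apply]
    _ ≤ _ := sum_abs_sub_le N t ht hm hk ν

/-- **THE η⁻¹-NORMALISED ROW (the letter as storey J reads it).**  For the `η⁻²`-stencil (`t = η⁻¹`, `η > 0`) with mass `m > 0`: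
`η⁻¹·Σ_y |G(x + e_ν, y) − G(x, y)| ≤ 2∕√(m²η² + 4m)`; at `m = 1`: `≤ 2∕√(η² + 4) < 1` uniformly in `η`, `d`, the volume, `x` and `ν`.
[folklore] [cite: Balaban1984PropagatorsI, (1.29) p.23] -/
theorem inv_eta_mul_sum_abs_green_sub_le {η : ℝ} (hη : 0 < η) {m : ℝ} (hm : 0 < m) {G : Tor N → Tor N → ℝ}
    (hG : ∀ y x, ∑ ν, η⁻¹ ^ 2 * ((G x y - G (x - unitVec N ν) y) + (G x y - G (x + unitVec N ν) y)) + m * G x y =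
      if x = y then 1 else 0)
    (x : Tor N) (ν : Fin d) : η⁻¹ * ∑ y : Tor N, |G (x + unitVec N ν) y - G x y| ≤ 2 / Real.sqrt (m ^ 2 * η ^ 2 + 4 * m) := by
  have h := sum_abs_green_sub_le N η⁻¹ (inv_ne_zero hη.ne') hm hG x ν
  -- `η⁻¹ · 2∕√(m² + 4mη⁻²) = 2∕√(m²η² + 4m)`
  have hsq : Real.sqrt (m ^ 2 + 4 * m * η⁻¹ ^ 2) = η⁻¹ * Real.sqrt (m ^ 2 * η ^ 2 + 4 * m) := by
    have e : m ^ 2 + 4 * m * η⁻¹ ^ 2 = η⁻¹ ^ 2 * (m ^ 2 * η ^ 2 + 4 * m) := by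
      rw [show η⁻¹ ^ 2 * (m ^ 2 * η ^ 2 + 4 * m) = m ^ 2 * (η⁻¹ * η) ^ 2 + 4 * m * η⁻¹ ^ 2 by ring,
        inv_mul_cancel₀ hη.ne', one_pow, mul_one]
    rw [e, Real.sqrt_mul (sq_nonneg _), Real.sqrt_sq (inv_pos.2 hη).le]
  calc η⁻¹ * ∑ y : Tor N, |G (x + unitVec N ν) y - G x y| ≤ η⁻¹ * (2 / Real.sqrt (m ^ 2 + 4 * m * η⁻¹ ^ 2)) :=
        mul_le_mul_of_nonneg_left h (inv_pos.2 hη).le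
    _ = 2 / Real.sqrt (m ^ 2 * η ^ 2 + 4 * m) := by
        rw [hsq, ← mul_div_assoc, mul_div_mul_left _ _ (inv_ne_zero hη.ne')]

/-! ## §2 Existence of the Green's function and the SOLUTION shape of the letter (vector-valued data) -/

/-- **EXISTENCE OF THE GREEN's FUNCTION** of `L₀ + m` on the finite torus (`m > 0`): `∃ G, (L₀ + m)G(·, y) = δ_y` for every `y` — the stencil
is an injective (uniqueness, `eq_of_resolvent_eq`) hence surjective endomorphism of the finite-dimensional space of lattice functions.
[folklore] [cite: Balaban1984PropagatorsI, (1.29) p.23] -/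
theorem exists_green (t : ℝ) {m : ℝ} (hm : 0 < m) :
    ∃ G : Tor N → Tor N → ℝ, ∀ y x, ∑ ν, t ^ 2 * ((G x y - G (x - unitVec N ν) y) + (G x y - G (x + unitVec N ν) y)) + m * G x y =
      if x = y then 1 else 0 := by
  classical
  -- the stencil as a linear endomorphism
  let Lop : (Tor N → ℝ) →ₗ[ℝ] (Tor N → ℝ) :=
    { toFun := fun φ x => ∑ ν, t ^ 2 * ((φ x - φ (x - unitVec N ν)) + (φ x - φ (x + unitVec N ν))) + m * φ x
      map_add' := fun φ ψ => by
        funext x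
        simp only [Pi.add_apply]
        rw [← add_add_add_comm, ← Finset.sum_add_distrib, mul_add]
        congr 1
        exact Finset.sum_congr rfl fun ν _ => by ring
      map_smul' := fun c φ => by
        funext x
        simp only [Pi.smul_apply, smul_eq_mul, RingHom.id_apply, Finset.mul_sum, mul_add]
        congr 1
        · exact Finset.sum_congr rfl fun ν _ => by ring
        · ring }
  have hinj : Function.Injective Lop := by
    intro φ₁ φ₂ h
    exact eq_of_resolvent_eq (V := Tor N) (ι := Fin d) (fun μ y => y - unitVec N μ) (fun μ y => y + unitVec N μ)
      (sq_nonneg t) hm (ψ := Lop φ₂) (fun x => by rw [← h]; rfl) (fun x => rfl)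
  have hsurj : Function.Surjective Lop := LinearMap.injective_iff_surjective.1 hinj
  choose φ hφ using fun y : Tor N => hsurj (fun x => if x = y then (1 : ℝ) else 0)
  exact ⟨fun x y => φ y x, fun y x => by have := congrFun (hφ y) x; exact this⟩

/-- **REPRESENTATION OF VECTOR-VALUED SOLUTIONS**: if `G` is the Green's function of `L₀ + m` and `u : T → V` (real normed space) solves
`(L₀ + m)u = g`, then `u(x) = Σ_y G(x, y)•g(y)` — both sides solve the equation after every continuous functional; scalar uniqueness; Hahn–Banach.
[folklore] [cite: Balaban1984PropagatorsI, (1.29) p.23] -/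
theorem apply_eq_sum_green_smul {V : Type*} [NormedAddCommGroup V] [NormedSpace ℝ V] (t : ℝ) {m : ℝ} (hm : 0 < m)
    {G : Tor N → Tor N → ℝ}
    (hG : ∀ y x, ∑ ν, t ^ 2 * ((G x y - G (x - unitVec N ν) y) + (G x y - G (x + unitVec N ν) y)) + m * G x y =
      if x = y then 1 else 0)
    {u g : Tor N → V} (hu : ∀ x, ∑ ν, t ^ 2 • ((u x - u (x - unitVec N ν)) + (u x - u (x + unitVec N ν))) + m • u x = g x)
    (x : Tor N) : u x = ∑ y, G x y • g y := by
  classical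
  rw [SeparatingDual.eq_iff_forall_dual_eq (R := ℝ)]
  intro ℓ
  -- `ℓ ∘ u` and `x ↦ Σ_y G(x,y)·ℓ(g y)` both solve the scalar equation with data `ℓ ∘ g`
  have h1 : ∀ z, ∑ ν, t ^ 2 * ((ℓ (u z) - ℓ (u (z - unitVec N ν))) + (ℓ (u z) - ℓ (u (z + unitVec N ν)))) + m * ℓ (u z) = ℓ (g z) := by
    intro z
    have := congrArg ℓ (hu z)
    simpa only [map_add, map_sum, map_smul, map_sub, smul_eq_mul] using this
  have h2 : ∀ z, ∑ ν, t ^ 2 * (((∑ y, G z y * ℓ (g y)) - ∑ y, G (z - unitVec N ν) y * ℓ (g y)) +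
      ((∑ y, G z y * ℓ (g y)) - ∑ y, G (z + unitVec N ν) y * ℓ (g y))) + m * ∑ y, G z y * ℓ (g y) = ℓ (g z) := by
    intro z
    have e : ∀ ν, t ^ 2 * (((∑ y, G z y * ℓ (g y)) - ∑ y, G (z - unitVec N ν) y * ℓ (g y)) +
        ((∑ y, G z y * ℓ (g y)) - ∑ y, G (z + unitVec N ν) y * ℓ (g y))) =
        ∑ y, t ^ 2 * ((G z y - G (z - unitVec N ν) y) + (G z y - G (z + unitVec N ν) y)) * ℓ (g y) := by
      intro ν
      rw [← Finset.sum_sub_distrib, ← Finset.sum_sub_distrib, ← Finset.sum_add_distrib, Finset.mul_sum]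
      exact Finset.sum_congr rfl fun y _ => by ring
    rw [Finset.sum_congr rfl fun ν _ => e ν, Finset.sum_comm, Finset.mul_sum, ← Finset.sum_add_distrib]
    rw [Finset.sum_congr rfl fun y _ => by rw [← mul_assoc, ← Finset.sum_mul, ← add_mul, hG y z]]
    simp [Finset.sum_ite_eq]
  have h := eq_of_resolvent_eq (V := Tor N) (ι := Fin d) (fun μ y => y - unitVec N μ) (fun μ y => y + unitVec N μ)
    (sq_nonneg t) hm (φ₁ := fun z => ℓ (u z)) (φ₂ := fun z => ∑ y, G z y * ℓ (g y)) h1 h2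
  have hx := congrFun h x
  rw [hx, map_sum]
  simp only [map_smul, smul_eq_mul]

/-- **THE (K∇) LETTER IN SOLUTION SHAPE**: for vector-valued data `g` with `‖g(y)‖ ≤ F` and the solution `u` of `(L₀ + m)u = g` on any finite
torus (`t ≠ 0`, `m > 0`): `‖u(x + e_ν) − u(x)‖ ≤ (2∕√(m² + 4mt²))·F` — the gradient row of the Green's function (`sum_abs_green_sub_le`) against
the sup of the data. [folklore] [cite: Balaban1984PropagatorsI, (1.29) p.23] -/
theorem norm_apply_sub_le_of_resolvent {V : Type*} [NormedAddCommGroup V] [NormedSpace ℝ V] (t : ℝ) (ht : t ≠ 0) {m : ℝ} (hm : 0 < m)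
    {u g : Tor N → V} (hu : ∀ x, ∑ ν, t ^ 2 • ((u x - u (x - unitVec N ν)) + (u x - u (x + unitVec N ν))) + m • u x = g x)
    {F : ℝ} (hg : ∀ y, ‖g y‖ ≤ F) (x : Tor N) (ν : Fin d) :
    ‖u (x + unitVec N ν) - u x‖ ≤ 2 / Real.sqrt (m ^ 2 + 4 * m * t ^ 2) * F := by
  obtain ⟨G, hG⟩ := exists_green N t hm
  have hF : 0 ≤ F := (norm_nonneg _).trans (hg 0)
  rw [apply_eq_sum_green_smul N t hm hG hu, apply_eq_sum_green_smul N t hm hG hu, ← Finset.sum_sub_distrib]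
  calc ‖∑ y, (G (x + unitVec N ν) y • g y - G x y • g y)‖
      ≤ ∑ y, ‖G (x + unitVec N ν) y • g y - G x y • g y‖ := norm_sum_le _ _
    _ ≤ ∑ y, |G (x + unitVec N ν) y - G x y| * F := Finset.sum_le_sum fun y _ => by
        rw [← sub_smul, norm_smul, Real.norm_eq_abs]
        exact mul_le_mul_of_nonneg_left (hg y) (abs_nonneg _)
    _ = (∑ y, |G (x + unitVec N ν) y - G x y|) * F := (Finset.sum_mul _ _ _).symm
    _ ≤ 2 / Real.sqrt (m ^ 2 + 4 * m * t ^ 2) * F :=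
        mul_le_mul_of_nonneg_right (sum_abs_green_sub_le N t ht hm hG x ν) hF

end Literature.MathematicalPhysics.QuantumFieldTheory.Balaban1983to89.B5Eq129FreeResolventGradientRow

end
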